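import Summits.MatrixMultiplication.OmegaCensus.STPP222PowFromCard
import Mathlib.Data.Nat.Log

/-!
# ω-census, STPP laws `(2,2,2)^k`: the quasi-polynomial uniform bound `N_k ≤ 26 · (832 k²)^{⌈log₂ k⌉}`

HONEST FRAMING (pub-omega census; verbatim): lottery ticket; floor = certified bounds/negative ranges.
Census STRUCTURE bookkeeping (question Q7 of the pub-omega cell, "order of growth" of the uniform threshold `N_k` = least order
from which EVERY finite abelian group admits `k` simultaneous-TPP triples of 2-subsets, CKSU 2005 Def. 5.1, tree form `IsSTPP`),
not progress on `ω`: a `(2,2,2)^k` family has volume `8k` and certifies no matrix-multiplication bound of any interest.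

`STPP222PowFromCard.lean` proves `N_k ≤ (416 k² + 416)^k` (`exists_isSTPP_222pow_of_card_ge`) by a halving recursion whose honest
growth is quasi-polynomial.  This file records that closed form in the kernel:

* `exists_isSTPP_222pow_of_card_ge_clog` — **every finite abelian group of order `≥ 26 · (832 k²)^{Nat.clog 2 k}` admits
  `(2,2,2)^k`**, i.e. `N_k ≤ 26 · (832 k²)^{⌈log₂ k⌉} = k^{O(log k)}`.  (Packing lower bound in the tree: `N_k ≥ 8k − 4`.)

Same proof as there (exponent `≥ 8k(k−1)+8`: cyclic theorem; else split `Π ℤ/qᵢ` into a greedy block of order in `[26, 832k²)`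
carrying `(2,2,2)²` and a complementary block of order `≥ 26·(832k²)^{⌈log₂ k⌉−1} ≥ 26·(832k'²)^{⌈log₂ k'⌉}`, `k' = ⌈k/2⌉`,
carrying `(2,2,2)^{k'}` by induction, via `Nat.clog_of_two_le : clog 2 k = clog 2 ⌈k/2⌉ + 1`; multiply, shrink, transport), with
the tools of `STPP222PowFromCard.lean`.  No sharpness claimed.

References: H. Cohn, R. Kleinberg, B. Szegedy, C. Umans, *Group-theoretic algorithms for matrix multiplication*, FOCS 2005
(arXiv:math/0511460), Def. 5.1.  Record: pub-omega HOME `STATUS.md` 2026-08-23 (stpp-3 gen 6), `STRUCTURE.md` Q7, row Pb51.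
-/

open Literature.Computability.AlgebraicComplexity Finset

namespace Summit.MatrixMultiplication.OmegaCensus

/-- The induction, over groups in `Type`: order `≥ 26 · (832 k²)^{clog 2 k}` forces `(2,2,2)^k`. [cite: CohnKleinbergSzegedyUmans2005, Def. 5.1] -/
theorem exists_isSTPP_222pow_of_card_ge_clog_aux (k : ℕ) :
    ∀ (G : Type) [AddCommGroup G] [Finite G], 26 * (832 * k ^ 2) ^ Nat.clog 2 k ≤ Nat.card G →
      ∃ A B C : Fin k → Finset G, IsSTPP A B C ∧ ∀ i, (A i).card = 2 ∧ (B i).card = 2 ∧ (C i).card = 2 := by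
  induction k using Nat.strong_induction_on with
  | _ k ih =>
    intro G _ _ hG
    classical
    rcases Nat.lt_or_ge k 3 with hk3 | hk3
    · interval_cases k
      · exact ⟨fun _ => ∅, fun _ => ∅, fun _ => ∅, fun i => i.elim0, fun i => i.elim0⟩
      · exact exists_isSTPP_222one_of_card (le_trans (by norm_num) hG)
      · exact exists_isSTPP_222sq_of_card (le_trans (by norm_num) (le_trans (Nat.le_mul_of_pos_right _ (by positivity)) hG))
    -- k ≥ 3
    set M : ℕ := 832 * k ^ 2 with hMdef
    set L : ℕ := Nat.clog 2 k with hLdef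
    set k' : ℕ := (k + 1) / 2 with hk'def
    have hk'lt : k' < k := by omega
    have hkk' : k ≤ 2 * k' := by omega
    have hMpos : 0 < M := by positivity
    have hL : L = Nat.clog 2 k' + 1 := by
      rw [hLdef, Nat.clog_of_two_le (by norm_num) (by omega)]
      have : (k + 2 - 1) / 2 = k' := by omega
      rw [this]
    have hL1 : 1 ≤ L := by rw [hL]; omega
    by_cases hexp : 8 * k * (k - 1) + 8 ≤ AddMonoid.exponent G
    · exact exists_isSTPP_222pow_of_exponent k hexp
    push Not at hexp
    obtain ⟨ι, _, q, hq0, hdvd, hcard, ⟨f⟩⟩ := exists_addEquiv_pi_zmod G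
    have hE : 0 < AddMonoid.exponent G := Nat.pos_of_ne_zero AddMonoid.exponent_ne_zero_of_finite
    have hqM : ∀ i, q i ≤ 16 * k ^ 2 + 16 := fun i => by
      have h1 := Nat.le_of_dvd hE (hdvd i)
      have h2 := cyclicThreshold_le_sq k
      omega
    -- 26 · M^L = M · (26 · M^(L-1))
    have hML : M * (26 * M ^ (L - 1)) = 26 * M ^ L := by
      have : M ^ L = M * M ^ (L - 1) := by
        rw [← pow_succ']; congr 1; omega
      rw [this]; ring
    have h26 : 26 ≤ ∏ i, q i := by
      rw [hcard]
      exact le_trans (Nat.le_mul_of_pos_right _ (by positivity)) hG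
    obtain ⟨t, -, ht1, ht2⟩ := exists_subset_prod_window q (T := 26) (M := 16 * k ^ 2 + 16) (by norm_num)
      (by omega) hq0 hqM univ h26
    have hk1 : 1 ≤ k ^ 2 := Nat.one_le_pow _ _ (by omega)
    have htM : ∏ i ∈ t, q i < M := by
      rw [hMdef]; omega
    -- the complementary block has order `≥ 26 · M^(L-1)`
    have hcompl : 26 * M ^ (L - 1) ≤ ∏ i ∈ tᶜ, q i := by
      by_contra hlt
      push Not at hlt
      have hpos : 0 < ∏ i ∈ t, q i := by omega
      have h1 : (∏ i ∈ t, q i) * ∏ i ∈ tᶜ, q i < (∏ i ∈ t, q i) * (26 * M ^ (L - 1)) :=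
        (Nat.mul_lt_mul_left hpos).2 hlt
      have h2 : (∏ i ∈ t, q i) * (26 * M ^ (L - 1)) ≤ M * (26 * M ^ (L - 1)) := Nat.mul_le_mul_right _ htM.le
      rw [Finset.prod_mul_prod_compl, hcard] at h1
      rw [hML] at h2
      omega
    have hbound' : 26 * (832 * k' ^ 2) ^ Nat.clog 2 k' ≤ ∏ i ∈ tᶜ, q i := by
      refine le_trans (Nat.mul_le_mul_left 26 ?_) hcompl
      have hkk : k' ^ 2 ≤ k ^ 2 := Nat.pow_le_pow_left hk'lt.le 2
      have hLk' : Nat.clog 2 k' = L - 1 := by omega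
      rw [hLk']
      exact Nat.pow_le_pow_left (by omega) _
    haveI : ∀ i, NeZero (q i) := fun i => ⟨(hq0 i).ne'⟩
    have h1 : ∃ A B C : Fin 2 → Finset (Π i : {i // i ∈ t}, ZMod (q i)), IsSTPP A B C ∧
        ∀ i, (A i).card = 2 ∧ (B i).card = 2 ∧ (C i).card = 2 :=
      exists_isSTPP_222sq_of_card (by rw [natCard_pi_zmod_mem]; exact ht1)
    have h2 : ∃ A B C : Fin k' → Finset (Π i : {i // i ∉ t}, ZMod (q i)), IsSTPP A B C ∧
        ∀ i, (A i).card = 2 ∧ (B i).card = 2 ∧ (C i).card = 2 :=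
      ih k' hk'lt (Π i : {i // i ∉ t}, ZMod (q i)) (by rw [natCard_pi_zmod_not_mem]; exact hbound')
    have h12 := exists_isSTPP_222pow_prod h1 h2 k hkk'
    obtain ⟨φ, hφ⟩ := exists_prodPi_injective (fun i => ZMod (q i)) t
    have h3 := exists_isSTPP_222pow_of_injective φ hφ h12
    exact exists_isSTPP_222pow_of_injective f.symm.toAddMonoidHom f.symm.injective h3

/-- **`N_k ≤ 26 · (832 k²)^{⌈log₂ k⌉}` (quasi-polynomial uniform threshold): every finite abelian group of order
`≥ 26 · (832 k²)^{Nat.clog 2 k}` admits `k` simultaneous-TPP triples of 2-subsets.**  The closed form of the halving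
recursion of `STPP222PowFromCard.lean`; no sharpness claimed. [cite: CohnKleinbergSzegedyUmans2005, Def. 5.1] -/
theorem exists_isSTPP_222pow_of_card_ge_clog (k : ℕ) {G : Type*} [AddCommGroup G] [Finite G]
    (hG : 26 * (832 * k ^ 2) ^ Nat.clog 2 k ≤ Nat.card G) :
    ∃ A B C : Fin k → Finset G, IsSTPP A B C ∧ ∀ i, (A i).card = 2 ∧ (B i).card = 2 ∧ (C i).card = 2 := by
  classical
  obtain ⟨ι, _, q, hq0, -, hcard, ⟨f⟩⟩ := exists_addEquiv_pi_zmod G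
  haveI : ∀ i, NeZero (q i) := fun i => ⟨(hq0 i).ne'⟩
  have hcard' : Nat.card (Π i, ZMod (q i)) = Nat.card G := by
    rw [Nat.card_pi, ← hcard]; simp
  have h := exists_isSTPP_222pow_of_card_ge_clog_aux k (Π i, ZMod (q i)) (by rw [hcard']; exact hG)
  exact exists_isSTPP_222pow_of_injective f.symm.toAddMonoidHom f.symm.injective h

end Summit.MatrixMultiplication.OmegaCensus
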